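import Summits.CriticalPhenomena.Ising3D.Control2DRecord
import Summits.CriticalPhenomena.Ising3D.Control2DNonVacuity
import Mathlib.Tactic.Linarith
import Mathlib.Tactic.NormNum
import HarnessLib

/-!
# The 2D control's kernel record is non-vacuous (one import for a referee: record ∧ witness)
(cell `pub-ising3x`, seat controls-1 gen 35 — CONTROL-ONLY)

HONEST FRAMING: lottery ticket; floor = tightest certified 3D Ising CFT bounds; no exact-solution
claim without a proof. CONTROL-ONLY (`d = 2`, `Δ_σ = 1/8`).

`Control2DRecord.control2D_record` indexes every kernel statement of the 2D blind control; each is an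
EXCLUSION over the hypothesis class `IsUnitary ∧ SatisfiesCrossing (1/8)` (plus item-specific gap /
`A2D′` clauses). `Control2DNonVacuity` proves that class non-empty (the two-dimensional generalised free
field of dimension `1/8`, scalar gap `1/4`). This file only pairs the two, so that one import carries
both the record and its non-vacuity witness:

* `record_gapThreshold_window` — `¬ GapExcluded (1/8) (1/4) ∧ GapExcluded (1/8) (20001/20000)`: the
  threshold of the typed one-sided item («`Δ_ε < U`») at `Δ_σ = 1/8` lies in `(1/4, 1.00005]`;
* `record_gapThreshold_rays` — by monotonicity, NO `U ≤ 1/4` is excluded and EVERY `U ≥ 20001/20000` is;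
* `control2D_record_witness` — the hypothesis class of the record is inhabited.

Elementary (composition by name). [folklore]
-/

namespace Summit.CriticalPhenomena.Ising3D.Control2D

open Set

/-- **Threshold window of the one-sided item at `Δ_σ = 1/8`**: the gap `1/4 = 2Δ_σ` is not excluded
(free-field witness, `not_gapExcluded_2d_quarter`) while `20001/20000` is (Λ = 19 kernel certificate,
`gapExcluded_2d_L19_gapC`). [folklore] -/
theorem record_gapThreshold_window :
    ¬ GapExcluded (1 / 8 : ℝ) (1 / 4) ∧ GapExcluded (1 / 8 : ℝ) (20001 / 20000) :=
  ⟨not_gapExcluded_2d_quarter, gapExcluded_2d_L19_gapC⟩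

/-- The two rays: no `U ≤ 1/4` is excluded, every `U ≥ 20001/20000` is (`GapExcluded.mono`).
[folklore] -/
theorem record_gapThreshold_rays (U : ℝ) :
    (U ≤ 1 / 4 → ¬ GapExcluded (1 / 8 : ℝ) U) ∧ (20001 / 20000 ≤ U → GapExcluded (1 / 8 : ℝ) U) :=
  ⟨fun hU => not_gapExcluded_of_le_two_mul (s := (1 / 8 : ℝ)) (by norm_num) (by linarith),
    fun hU => gapExcluded_2d_L19_gapC.mono hU⟩

/-- **The record's hypothesis class is inhabited**: a parity-symmetric unitary solution of the 2D
`⟨σσσσ⟩` sum rule at `Δ_σ = 1/8` with scalar gap `1/4` exists in the tree's conventions (the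
generalised free field; `Control2DNonVacuity.crossingData_nonvacuous_eighth`), next to the record
itself (`control2D_record`). [folklore] -/
theorem control2D_record_witness :
    (∃ D : CrossingData, D.IsUnitary ∧ D.SatisfiesCrossing (1 / 8 : ℝ) ∧ D.HasScalarGap (1 / 4)) ∧
      GapExcluded (1 / 8 : ℝ) (20001 / 20000) ∧
        (∀ w : ℝ, TwoSided (1 / 8 : ℝ) 2 1 w (99 / 100) (20001 / 20000)) :=
  ⟨crossingData_nonvacuous_eighth, gapExcluded_2d_L19_gapC, twoSided_2d_kernel099⟩

end Summit.CriticalPhenomena.Ising3D.Control2D
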